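import Mathlib.Data.Set.Finite.Lemmas
import Literature.ModelTheory.Quasiminimal.PregeometryStructures
import HarnessLib

/-!
# Partial embeddings and the back-and-forth method in quasiminimal pregeometry structures

J. Kirby, *On quasiminimal excellent classes*, J. Symbolic Logic 75 (2010) 551–564 ("OQMEC"),
§§1–2, and M. Bays, B. Hart, T. Hyttinen, M. Kesälä, J. Kirby, *Quasiminimal structures and
excellence*, Bull. LMS 46 (2014) 155–163, §§2–3, work with **partial embeddings**
`f : H ⇀ H'` — partial maps preserving quantifier-free formulas — and build closed embeddings and
automorphisms out of them by countable back-and-forth arguments driven by the axioms of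
quasiminimal pregeometry structures (`ℵ₀`-homogeneity over closed sets, QM5, for the inner
steps; uniqueness of the generic type, QM4, for new independent points).

This file sets up that calculus inside ONE structure `M` (OQMEC §§2–3 and BHHKK §§3–6 work inside
a model and its countable closed subsets), on top of the tree's
`Literature.ModelTheory.Quasiminimal.IsWeaklyQuasiminimalPregeometryStructure` and
`FirstOrder.Language.EqQFType` / `EqQFTypeOver` (file `PregeometryStructures.lean`):

* `IsQFEmbOn L f A` — the total map `f : M → M` restricted to `A ⊆ M` is a partial embedding:
  every finite tuple from `A` has the same quantifier-free type as its image (OQMEC §1, the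
  "partial embeddings" of Def. 1.1 and axioms I–II). API: restriction, composition, inverses, unions of directed families,
  the relation with `EqQFTypeOver` (`isQFEmbOn_union_range_iff`), preservation of the closure
  (`IsQFEmbOn.mem_cl_image`, OQMEC axiom I.3 = QM1; inverses via `Function.invFunOn`).
* `exists_map_of_backAndForth` — the abstract countable back-and-forth engine: a relation on
  pairs of finite tuples which can always be extended by a point of `C` on the left and a point
  of `C'` on the right yields a map carrying `C` onto `C'` all of whose finite restrictions are
  covered by related pairs.
* `IsWeaklyQuasiminimalPregeometryStructure.exists_isQFEmbOn_cl_extend` — **closure extension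
  over a closed set** (the successor step of OQMEC Thm 2.1, and BHHKK Lemma 3.1's back-and-forth):
  in a weakly quasiminimal pregeometry structure, if `G` is countable and closed (or empty), `f`
  is a partial embedding on `G` with closed image and `qftp(G, t) = qftp(f[G], t')`, then
  `f ∪ (t ↦ t')` extends to a partial embedding of `cl (G ∪ t)` onto `cl (f[G] ∪ t')`.
* `….eqQFTypeOver_snoc_of_notMem_cl` — **generic one-point extension** (QM4 with seeds): under
  the same hypotheses, points `a ∉ cl (G ∪ t)`, `a' ∉ cl (f[G] ∪ t')` may be matched.

The theorems of OQMEC §2 proper (Thm 2.1: closed embeddings along independent families;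
Prop. 2.3 = BHHKK Lemma 3.1: types over closed sets are automorphism orbits) are assembled from
these in `CountableModels.lean`.

## Design

Partial maps are total functions `f : M → M` together with the set on which they are meant
(the tree's convention for `EqQFTypeOver H f`); "`f ∪ (t ↦ t')` is a partial embedding" is
`L.EqQFTypeOver G f t t'` (and `IsQFEmbOn L f A ↔ L.EqQFTypeOver A f Fin.elim0 Fin.elim0`,
`isQFEmbOn_iff_eqQFTypeOver_elim0`). The base set `G` is assumed countable (as in the sources:
Kirby's `G` is "empty or closed and countable"); `M` itself is arbitrary. Everything here is
proved; nothing is specific to a countable language.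

## References

* J. Kirby, *On quasiminimal excellent classes*, J. Symbolic Logic 75 (2010) 551–564,
  arXiv:0707.4496: §1 (partial embeddings, axioms I–II), Thm 2.1, Prop. 2.3.
* M. Bays, B. Hart, T. Hyttinen, M. Kesälä, J. Kirby, *Quasiminimal structures and excellence*,
  Bull. London Math. Soc. 46 (2014) 155–163, arXiv:1210.2008: Def. 2.1, Lemma 3.1.
-/

noncomputable section

open Set FirstOrder FirstOrder.Language

universe u v w

namespace Literature.ModelTheory.Quasiminimal

variable {L : Language.{u, v}} {M : Type w} [L.Structure M]

/-! ### Quantifier-free types of concatenated tuples: bookkeeping -/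

section Tuples

variable {m n : ℕ}

omit [L.Structure M] in
/-- The range of `Fin.append u x` is `range u ∪ range x`. [folklore] -/
theorem range_append (u : Fin m → M) (x : Fin n → M) :
    range (Fin.append u x) = range u ∪ range x := by
  ext b
  simp only [mem_range, mem_union]
  constructor
  · rintro ⟨i, rfl⟩
    refine Fin.addCases (fun j => ?_) (fun j => ?_) i
    · exact Or.inl ⟨j, by simp⟩
    · exact Or.inr ⟨j, by simp⟩
  · rintro (⟨i, rfl⟩ | ⟨i, rfl⟩)
    · exact ⟨Fin.castAdd n i, by simp⟩
    · exact ⟨Fin.natAdd m i, by simp⟩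

/-- From `qftp(u, x) = qftp(u', y)`: `qftp(x) = qftp(y)`. [folklore] -/
theorem _root_.FirstOrder.Language.EqQFType.append_right {u u' : Fin m → M} {x y : Fin n → M}
    (h : L.EqQFType (Fin.append u x) (Fin.append u' y)) : L.EqQFType x y := by
  refine (h.comp (Fin.natAdd m)).congr ?_ ?_ <;> funext i <;> simp

/-- From `qftp(u, x) = qftp(u', y)`: `qftp(u) = qftp(u')`. [folklore] -/
theorem _root_.FirstOrder.Language.EqQFType.append_left {u u' : Fin m → M} {x y : Fin n → M}
    (h : L.EqQFType (Fin.append u x) (Fin.append u' y)) : L.EqQFType u u' := by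
  refine (h.comp (Fin.castAdd n)).congr ?_ ?_ <;> funext i <;> simp

/-- Tuples with the same quantifier-free type have the same coincidences among coordinates
(one direction of `EqQFType.apply_eq_iff`, as a function). [folklore] -/
theorem _root_.FirstOrder.Language.EqQFType.eq_of_eq {x y : Fin n → M} (h : L.EqQFType x y)
    {i j : Fin n} (hij : x i = x j) : y i = y j :=
  (h.apply_eq_iff i j).1 hij

/-- In `qftp(u, x) = qftp(u', y)`, a coincidence `u i = x j` forces `u' i = y j`. [folklore] -/
theorem _root_.FirstOrder.Language.EqQFType.append_eq {u u' : Fin m → M} {x y : Fin n → M}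
    (h : L.EqQFType (Fin.append u x) (Fin.append u' y)) {i : Fin m} {j : Fin n}
    (hij : u i = x j) : u' i = y j := by
  have := h.eq_of_eq (i := Fin.castAdd n i) (j := Fin.natAdd m j) (by simpa using hij)
  simpa using this

end Tuples

/-! ### Partial embeddings -/

section PartialEmbeddings

variable (L)

/-- **Partial embeddings.** `IsQFEmbOn L f A`: the map `f`, restricted to `A ⊆ M`, is a partial
embedding of `M` into itself — every finite tuple from `A` has the same quantifier-free type as
its image under `f` (Kirby 2010, §1: "partial embedding", a partial map preserving
quantifier-free formulas; BHHKK 2014 §2). [cite: Kirby2010QMEC, §1 (Definition 1.1, axioms I–II)] -/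
def IsQFEmbOn (f : M → M) (A : Set M) : Prop :=
  ∀ ⦃n : ℕ⦄ (x : Fin n → M), (∀ i, x i ∈ A) → L.EqQFType x (f ∘ x)

variable {L}

namespace IsQFEmbOn

variable {f g : M → M} {A B : Set M}

/-- Restriction of a partial embedding. [folklore] -/
theorem mono (h : IsQFEmbOn L f A) (hBA : B ⊆ A) : IsQFEmbOn L f B :=
  fun _ x hx => h x fun i => hBA (hx i)

/-- The identity is a partial embedding on any set. [folklore] -/
theorem id (A : Set M) : IsQFEmbOn L id A := fun _ x _ => EqQFType.refl x

/-- Partial embeddings only depend on their values on the set. [folklore] -/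
theorem congr (h : IsQFEmbOn L f A) (hfg : EqOn f g A) : IsQFEmbOn L g A := by
  intro n x hx
  have : g ∘ x = f ∘ x := funext fun i => (hfg (hx i)).symm
  rw [this]
  exact h x hx

/-- Composition of partial embeddings. [folklore] -/
theorem comp (hf : IsQFEmbOn L f A) (hg : IsQFEmbOn L g (f '' A)) : IsQFEmbOn L (g ∘ f) A :=
  fun _ x hx => (hf x hx).trans (hg (f ∘ x) fun i => mem_image_of_mem f (hx i))

/-- A partial embedding is injective on its set. [folklore] -/
theorem injOn (h : IsQFEmbOn L f A) : InjOn f A := by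
  intro a ha b hb hab
  have hx : ∀ i : Fin 2, ![a, b] i ∈ A := fun i => by
    refine Fin.cases ?_ (fun j => ?_) i
    · simpa using ha
    · simpa [Fin.fin_one_eq_zero j] using hb
  have h01 := ((h ![a, b] hx).apply_eq_iff 0 1).2 (by simpa using hab)
  simpa using h01

/-- A left inverse of a partial embedding is a partial embedding on the image. [folklore] -/
theorem inverse (hf : IsQFEmbOn L f A) (hg : ∀ a ∈ A, g (f a) = a) : IsQFEmbOn L g (f '' A) := by
  intro n y hy
  choose x hxA hxy using hy
  have hyx : y = f ∘ x := funext fun i => (hxy i).symm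
  have hgx : g ∘ y = x := funext fun i => by rw [hyx, Function.comp_apply, Function.comp_apply, hg _ (hxA i)]
  rw [hgx, hyx]
  exact (hf x hxA).symm

/-- A map which is a partial embedding on each member of a directed family of sets is a partial
embedding on the union (finite tuples live in one member). [folklore] -/
theorem iUnion {ι : Type*} [Nonempty ι] {A : ι → Set M} (hdir : Directed (· ⊆ ·) A)
    (h : ∀ i, IsQFEmbOn L f (A i)) : IsQFEmbOn L f (⋃ i, A i) := by
  intro n x hx
  have : ∀ j : Fin n, ∃ i, x j ∈ A i := fun j => mem_iUnion.1 (hx j)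
  choose i hi using this
  classical
  obtain ⟨k, hk⟩ := hdir.finset_le (Finset.univ.image i)
  exact h k x fun j => hk (i j) (Finset.mem_image_of_mem i (Finset.mem_univ j)) (hi j)

/-- Monotone unions: a map which is a partial embedding on each `A k`, `A` monotone in `k : ℕ`,
is a partial embedding on `⋃ k, A k`. [folklore] -/
theorem iUnion_nat {A : ℕ → Set M} (hmono : Monotone A) (h : ∀ k, IsQFEmbOn L f (A k)) :
    IsQFEmbOn L f (⋃ k, A k) :=
  iUnion hmono.directed_le h

end IsQFEmbOn

/-! ### Partial embeddings and `EqQFTypeOver` -/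

/-- A partial embedding on `A` matches `A` to its image: `qftp(A) = qftp(f[A])`
(`EqQFTypeOver` with empty extra tuples). [folklore] -/
theorem IsQFEmbOn.eqQFTypeOver_elim0 {f : M → M} {A : Set M} (h : IsQFEmbOn L f A) :
    L.EqQFTypeOver A f (Fin.elim0 : Fin 0 → M) Fin.elim0 :=
  FirstOrder.Language.eqQFTypeOver_elim0 fun _ σ hσ => h σ hσ

/-- The two spellings of "`f` is a partial embedding on `A`" agree: `IsQFEmbOn L f A` iff
`qftp(A) = qftp(f[A])` (`EqQFTypeOver` with empty extra tuples, the form used in QM4).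
[folklore] -/
theorem isQFEmbOn_iff_eqQFTypeOver_elim0 {f : M → M} {A : Set M} :
    IsQFEmbOn L f A ↔ L.EqQFTypeOver A f (Fin.elim0 : Fin 0 → M) Fin.elim0 :=
  ⟨fun h => h.eqQFTypeOver_elim0, fun h _ σ hσ => h.of_elim0 σ hσ⟩

/-- A partial embedding on `A ∪ range t` gives `qftp(A, t) = qftp(f[A], f ∘ t)`. [folklore] -/
theorem IsQFEmbOn.eqQFTypeOver {f : M → M} {A : Set M} {k : ℕ} {t : Fin k → M}
    (h : IsQFEmbOn L f (A ∪ range t)) : L.EqQFTypeOver A f t (f ∘ t) := by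
  intro m σ hσ
  have : f ∘ Fin.append σ t = Fin.append (f ∘ σ) (f ∘ t) := by
    funext i
    refine Fin.addCases (fun j => ?_) (fun j => ?_) i <;> simp
  rw [← this]
  refine h _ fun i => ?_
  refine Fin.addCases (fun j => ?_) (fun j => ?_) i
  · simpa using Or.inl (hσ j)
  · simp

/-- Conversely, `qftp(A, t) = qftp(f[A], t')` with `t' = f ∘ t` and `f` a partial embedding on `A`
make `f` a partial embedding on `A ∪ range t`. [folklore] -/
theorem isQFEmbOn_union_range {f : M → M} {A : Set M} {k : ℕ} {t : Fin k → M}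
    (ht : L.EqQFTypeOver A f t (f ∘ t)) : IsQFEmbOn L f (A ∪ range t) := by
  classical
  intro n x hx
  -- coordinates of `x` in `A`, enumerated
  let s : Finset (Fin n) := Finset.univ.filter fun i => x i ∈ A
  let e : Fin s.card ≃ s := (Finset.equivFin s).symm
  let σ : Fin s.card → M := fun j => x (e j)
  have hσ : ∀ j, σ j ∈ A := fun j => (Finset.mem_filter.1 (e j).2).2
  -- each coordinate not in `A` is some `t j`
  have hsel : ∀ i : Fin n, x i ∉ A → ∃ j, t j = x i := fun i hi => by
    rcases hx i with h | ⟨j, hj⟩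
    · exact absurd h hi
    · exact ⟨j, hj⟩
  let ι : Fin n → Fin (s.card + k) := fun i =>
    if hi : x i ∈ A then Fin.castAdd k (e.symm ⟨i, Finset.mem_filter.2 ⟨Finset.mem_univ _, hi⟩⟩)
    else Fin.natAdd s.card (hsel i hi).choose
  have key := ht σ hσ
  have h1 : Fin.append σ t ∘ ι = x := by
    funext i
    by_cases hi : x i ∈ A
    · simp only [Function.comp_apply, ι, dif_pos hi, Fin.append_left, σ, Equiv.apply_symm_apply]
    · simp only [Function.comp_apply, ι, dif_neg hi, Fin.append_right]
      exact (hsel i hi).choose_spec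
  have h2 : Fin.append (f ∘ σ) (f ∘ t) ∘ ι = f ∘ x := by
    funext i
    by_cases hi : x i ∈ A
    · simp only [Function.comp_apply, ι, dif_pos hi, Fin.append_left, σ, Equiv.apply_symm_apply]
    · simp only [Function.comp_apply, ι, dif_neg hi, Fin.append_right]
      exact congr_arg f (hsel i hi).choose_spec
  have := key.comp ι
  rw [h1, h2] at this
  exact this

/-- `IsQFEmbOn L f (A ∪ range t)` iff `f` is a partial embedding on `A` and
`qftp(A, t) = qftp(f[A], f ∘ t)`. [folklore] -/
theorem isQFEmbOn_union_range_iff {f : M → M} {A : Set M} {k : ℕ} {t : Fin k → M} :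
    IsQFEmbOn L f (A ∪ range t) ↔ IsQFEmbOn L f A ∧ L.EqQFTypeOver A f t (f ∘ t) :=
  ⟨fun h => ⟨h.mono subset_union_left, h.eqQFTypeOver⟩, fun h => isQFEmbOn_union_range h.2⟩

/-- **Symmetry of `EqQFTypeOver` under inverses.** If `qftp(G, t) = qftp(f[G], t')` and `g`
inverts `f` on `G`, then `qftp(f[G], t') = qftp(g[f[G]], t)` along `g`. [folklore] -/
theorem _root_.FirstOrder.Language.EqQFTypeOver.symm_of_inverse {G : Set M} {f g : M → M}
    {k : ℕ} {t t' : Fin k → M} (h : L.EqQFTypeOver G f t t') (hg : ∀ a ∈ G, g (f a) = a) :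
    L.EqQFTypeOver (f '' G) g t' t := by
  intro m σ' hσ'
  choose σ hσG hσ using hσ'
  have h1 : (σ' : Fin m → M) = f ∘ σ := funext fun i => (hσ i).symm
  have h2 : g ∘ σ' = σ := funext fun i => by
    rw [Function.comp_apply, ← hσ i, hg _ (hσG i)]
  rw [h2, h1]
  exact (h σ hσG).symm

/-- `EqQFTypeOver` is monotone in the tuples: appending further matched points can be undone.
[folklore] -/
theorem _root_.FirstOrder.Language.EqQFTypeOver.append_left {G : Set M} {f : M → M} {k n : ℕ}
    {t t' : Fin k → M} {x y : Fin n → M}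
    (h : L.EqQFTypeOver G f (Fin.append t x) (Fin.append t' y)) : L.EqQFTypeOver G f t t' := by
  intro m σ hσ
  have := h σ hσ
  have e1 : Fin.append σ (Fin.append t x) = Fin.append (Fin.append σ t) x ∘ Fin.cast (Nat.add_assoc ..).symm := by
    rw [Fin.append_assoc]
    rfl
  have e2 : Fin.append (f ∘ σ) (Fin.append t' y) = Fin.append (Fin.append (f ∘ σ) t') y ∘ Fin.cast (Nat.add_assoc ..).symm := by
    rw [Fin.append_assoc]
    rfl
  rw [e1, e2] at this
  have := (this.comp (Fin.cast (Nat.add_assoc ..))).append_left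
  · refine this.congr ?_ ?_ <;> funext i <;> simp

/-- `qftp(G, t) = qftp(f[G], t')` gives `qftp(t) = qftp(t')`-coincidences: `t i = t j ↔ t' i = t' j`.
[folklore] -/
theorem _root_.FirstOrder.Language.EqQFTypeOver.apply_eq_iff {G : Set M} {f : M → M} {k : ℕ}
    {t t' : Fin k → M} (h : L.EqQFTypeOver G f t t') (i j : Fin k) : t i = t j ↔ t' i = t' j :=
  h.eqQFType.apply_eq_iff i j

/-- In `qftp(G, t) = qftp(f[G], t')`, a coincidence `a = t j` with `a ∈ G` forces `f a = t' j`.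
[folklore] -/
theorem _root_.FirstOrder.Language.EqQFTypeOver.apply_eq_of_mem {G : Set M} {f : M → M} {k : ℕ}
    {t t' : Fin k → M} (h : L.EqQFTypeOver G f t t') {a : M} (ha : a ∈ G) {j : Fin k}
    (hj : a = t j) : f a = t' j := by
  have := h ![a] (fun i => by simpa using ha)
  have key := this.append_eq (i := 0) (j := j) (by simpa using hj)
  simpa using key

end PartialEmbeddings

/-! ### The countable back-and-forth engine -/

section BackAndForth

/-- **Abstract back-and-forth** (the "standard back-and-forth argument", Kirby 2010, proofs of
Thm 2.1 and Lemma 3.2; BHHKK 2014 §3). Let `S n x y` be a relation on pairs of `n`-tuples,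
holding for the empty tuples, preserving coincidences of coordinates, and such that a related
pair of tuples from countable sets `C`, `C'` can be extended by any point of `C` on the left
("forth") and any point of `C'` on the right ("back"). Then there is a map `g` with
`g '' C = C'` such that every finite tuple from `C` sits inside the left half of a related pair
whose right half is its `g`-image. [folklore] -/
theorem exists_map_of_backAndForth {S : ∀ n : ℕ, (Fin n → M) → (Fin n → M) → Prop}
    {C C' : Set M} (hC : C.Countable) (hC' : C'.Countable)
    (h0 : S 0 Fin.elim0 Fin.elim0)
    (hwd : ∀ ⦃n⦄ ⦃x y : Fin n → M⦄, S n x y → ∀ i j, x i = x j ↔ y i = y j)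
    (forth : ∀ ⦃n⦄ ⦃x y : Fin n → M⦄, S n x y → (∀ i, x i ∈ C) → (∀ i, y i ∈ C') →
      ∀ a ∈ C, ∃ b ∈ C', S (n + 1) (Fin.snoc x a) (Fin.snoc y b))
    (back : ∀ ⦃n⦄ ⦃x y : Fin n → M⦄, S n x y → (∀ i, x i ∈ C) → (∀ i, y i ∈ C') →
      ∀ b ∈ C', ∃ a ∈ C, S (n + 1) (Fin.snoc x a) (Fin.snoc y b)) :
    ∃ g : M → M, g '' C = C' ∧
      ∀ ⦃m : ℕ⦄ (σ : Fin m → M), (∀ i, σ i ∈ C) →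
        ∃ (n : ℕ) (x y : Fin n → M), S n x y ∧ (∀ i, x i ∈ C) ∧ (∀ i, y i ∈ C') ∧
          ∃ ι : Fin m → Fin n, x ∘ ι = σ ∧ y ∘ ι = g ∘ σ := by
  classical
  -- degenerate cases
  by_cases hCe : C = ∅
  · have hC'e : C' = ∅ := by
      by_contra hne
      obtain ⟨b, hb⟩ := nonempty_iff_ne_empty.2 hne
      obtain ⟨a, ha, -⟩ := back h0 (fun i => i.elim0) (fun i => i.elim0) b hb
      rw [hCe] at ha
      exact ha
    subst hCe hC'e
    refine ⟨id, by simp, fun m σ hσ => ?_⟩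
    rcases Nat.eq_zero_or_pos m with rfl | hm
    · refine ⟨0, Fin.elim0, Fin.elim0, h0, fun i => i.elim0, fun i => i.elim0, Fin.elim0, ?_, ?_⟩ <;>
        funext i <;> exact i.elim0
    · exact absurd (hσ ⟨0, hm⟩) (notMem_empty _)
  by_cases hC'e : C' = ∅
  · exfalso
    obtain ⟨a, ha⟩ := nonempty_iff_ne_empty.2 hCe
    obtain ⟨b, hb, -⟩ := forth h0 (fun i => i.elim0) (fun i => i.elim0) a ha
    rw [hC'e] at hb
    exact hb
  have hCne : C.Nonempty := nonempty_iff_ne_empty.2 hCe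
  have hC'ne : C'.Nonempty := nonempty_iff_ne_empty.2 hC'e
  obtain ⟨e, he⟩ := hC.exists_eq_range hCne
  obtain ⟨e', he'⟩ := hC'.exists_eq_range hC'ne
  -- states
  let tup : ℕ × (ℕ → M) × (ℕ → M) → (k : ℕ) → (Fin k → M) × (Fin k → M) :=
    fun s k => (fun i => s.2.1 i, fun i => s.2.2 i)
  let s₀ : ℕ × (ℕ → M) × (ℕ → M) := (0, fun _ => e 0, fun _ => e' 0)
  let Ext : (ℕ × (ℕ → M) × (ℕ → M)) → (ℕ × (ℕ → M) × (ℕ → M)) → Prop := fun s s' =>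
    s.1 ≤ s'.1 ∧ ∀ i < s.1, s'.2.1 i = s.2.1 i ∧ s'.2.2 i = s.2.2 i
  let Good : (ℕ × (ℕ → M) × (ℕ → M)) → Prop := fun s =>
    S s.1 (tup s s.1).1 (tup s s.1).2 ∧ (∀ i < s.1, s.2.1 i ∈ C) ∧ (∀ i < s.1, s.2.2 i ∈ C')
  have hExt_refl : ∀ s, Ext s s := fun s => ⟨le_rfl, fun i _ => ⟨rfl, rfl⟩⟩
  have hExt_trans : ∀ s s' s'', Ext s s' → Ext s' s'' → Ext s s'' := by
    rintro s s' s'' ⟨h1, h1'⟩ ⟨h2, h2'⟩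
    refine ⟨h1.trans h2, fun i hi => ?_⟩
    obtain ⟨ha, hb⟩ := h1' i hi
    obtain ⟨ha', hb'⟩ := h2' i (lt_of_lt_of_le hi h1)
    exact ⟨ha'.trans ha, hb'.trans hb⟩
  have hGood₀ : Good s₀ := by
    refine ⟨?_, fun i hi => absurd hi (Nat.not_lt_zero i), fun i hi => absurd hi (Nat.not_lt_zero i)⟩
    have e1 : (tup s₀ 0).1 = Fin.elim0 := funext fun i => i.elim0
    have e2 : (tup s₀ 0).2 = Fin.elim0 := funext fun i => i.elim0
    change S 0 (tup s₀ 0).1 (tup s₀ 0).2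
    rw [e1, e2]
    exact h0
  have htup1 : ∀ s, ∀ i : Fin s.1, (tup s s.1).1 i = s.2.1 i := fun s i => rfl
  have htup2 : ∀ s, ∀ i : Fin s.1, (tup s s.1).2 i = s.2.2 i := fun s i => rfl
  -- forth step
  have hforth : ∀ s, Good s → ∀ a ∈ C, ∃ s', Good s' ∧ Ext s s' ∧ s'.1 = s.1 + 1 ∧
      s'.2.1 s.1 = a := by
    rintro s ⟨hS, hm1, hm2⟩ a ha
    obtain ⟨b, hb, hS'⟩ := forth hS (fun i => hm1 i i.isLt) (fun i => hm2 i i.isLt) a ha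
    let s' : ℕ × (ℕ → M) × (ℕ → M) :=
      (s.1 + 1, fun i => if i = s.1 then a else s.2.1 i, fun i => if i = s.1 then b else s.2.2 i)
    have hext : Ext s s' := ⟨Nat.le_succ _, fun i hi =>
      ⟨(if_neg (Nat.ne_of_lt hi) : (if i = s.1 then a else s.2.1 i) = s.2.1 i),
        (if_neg (Nat.ne_of_lt hi) : (if i = s.1 then b else s.2.2 i) = s.2.2 i)⟩⟩
    refine ⟨s', ⟨?_, ?_, ?_⟩, hext, rfl, by simp [s']⟩
    · change S (s.1 + 1) (fun i : Fin (s.1 + 1) => if (i : ℕ) = s.1 then a else s.2.1 i)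
        (fun i : Fin (s.1 + 1) => if (i : ℕ) = s.1 then b else s.2.2 i)
      rw [IsWeaklyQuasiminimalPregeometryStructure.tuple_update_eq_snoc,
        IsWeaklyQuasiminimalPregeometryStructure.tuple_update_eq_snoc]
      exact hS'
    · intro i hi
      change (if i = s.1 then a else s.2.1 i) ∈ C
      split_ifs with hi'
      · exact ha
      · exact hm1 i (by change i < s.1 + 1 at hi; omega)
    · intro i hi
      change (if i = s.1 then b else s.2.2 i) ∈ C'
      split_ifs with hi'
      · exact hb
      · exact hm2 i (by change i < s.1 + 1 at hi; omega)
  -- back step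
  have hback : ∀ s, Good s → ∀ b ∈ C', ∃ s', Good s' ∧ Ext s s' ∧ s'.1 = s.1 + 1 ∧
      s'.2.2 s.1 = b := by
    rintro s ⟨hS, hm1, hm2⟩ b hb
    obtain ⟨a, ha, hS'⟩ := back hS (fun i => hm1 i i.isLt) (fun i => hm2 i i.isLt) b hb
    let s' : ℕ × (ℕ → M) × (ℕ → M) :=
      (s.1 + 1, fun i => if i = s.1 then a else s.2.1 i, fun i => if i = s.1 then b else s.2.2 i)
    have hext : Ext s s' := ⟨Nat.le_succ _, fun i hi =>
      ⟨(if_neg (Nat.ne_of_lt hi) : (if i = s.1 then a else s.2.1 i) = s.2.1 i),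
        (if_neg (Nat.ne_of_lt hi) : (if i = s.1 then b else s.2.2 i) = s.2.2 i)⟩⟩
    refine ⟨s', ⟨?_, ?_, ?_⟩, hext, rfl, by simp [s']⟩
    · change S (s.1 + 1) (fun i : Fin (s.1 + 1) => if (i : ℕ) = s.1 then a else s.2.1 i)
        (fun i : Fin (s.1 + 1) => if (i : ℕ) = s.1 then b else s.2.2 i)
      rw [IsWeaklyQuasiminimalPregeometryStructure.tuple_update_eq_snoc,
        IsWeaklyQuasiminimalPregeometryStructure.tuple_update_eq_snoc]
      exact hS'
    · intro i hi
      change (if i = s.1 then a else s.2.1 i) ∈ C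
      split_ifs with hi'
      · exact ha
      · exact hm1 i (by change i < s.1 + 1 at hi; omega)
    · intro i hi
      change (if i = s.1 then b else s.2.2 i) ∈ C'
      split_ifs with hi'
      · exact hb
      · exact hm2 i (by change i < s.1 + 1 at hi; omega)
  -- combined step
  have hstep : ∀ s, Good s → ∀ j : ℕ, ∃ s', Good s' ∧ Ext s s' ∧
      (∃ i < s'.1, s'.2.1 i = e j) ∧ (∃ i < s'.1, s'.2.2 i = e' j) := by
    intro s hs j
    obtain ⟨s₁, hs₁, hext₁, hlen₁, hval₁⟩ := hforth s hs (e j) (he ▸ mem_range_self j)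
    obtain ⟨s₂, hs₂, hext₂, hlen₂, hval₂⟩ := hback s₁ hs₁ (e' j) (he' ▸ mem_range_self j)
    refine ⟨s₂, hs₂, hExt_trans _ _ _ hext₁ hext₂, ⟨s.1, by omega, ?_⟩, ⟨s₁.1, by omega, hval₂⟩⟩
    rw [(hext₂.2 s.1 (by omega)).1, hval₁]
  choose! F hF using hstep
  let seq : ℕ → ℕ × (ℕ → M) × (ℕ → M) := fun j => Nat.rec s₀ (fun j s => F s j) j
  have hseq_succ : ∀ j, seq (j + 1) = F (seq j) j := fun j => rfl
  have hGood : ∀ j, Good (seq j) := by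
    intro j
    induction j with
    | zero => exact hGood₀
    | succ j ih => rw [hseq_succ]; exact (hF _ ih j).1
  have hExt_succ : ∀ j, Ext (seq j) (seq (j + 1)) := fun j => by
    rw [hseq_succ]; exact (hF _ (hGood j) j).2.1
  have hExt_le : ∀ {j j'}, j ≤ j' → Ext (seq j) (seq j') := by
    intro j j' hjj'
    induction hjj' with
    | refl => exact hExt_refl _
    | step _ ih => exact hExt_trans _ _ _ ih (hExt_succ _)
  -- the graph of the limit map
  let R : M → M → Prop := fun m m' => ∃ j, ∃ i < (seq j).1, (seq j).2.1 i = m ∧ (seq j).2.2 i = m'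
  have hR_lift : ∀ {m m' j J}, j ≤ J → (∃ i < (seq j).1, (seq j).2.1 i = m ∧ (seq j).2.2 i = m') →
      ∃ i < (seq J).1, (seq J).2.1 i = m ∧ (seq J).2.2 i = m' := by
    rintro m m' j J hjJ ⟨i, hi, h1, h2⟩
    obtain ⟨hle, hext⟩ := hExt_le hjJ
    exact ⟨i, lt_of_lt_of_le hi hle, (hext i hi).1.trans h1, (hext i hi).2.trans h2⟩
  have hR_fun : ∀ {m m₁ m₂}, R m m₁ → R m m₂ → m₁ = m₂ := by
    rintro m m₁ m₂ ⟨j₁, hj₁⟩ ⟨j₂, hj₂⟩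
    obtain ⟨i₁, hi₁, h₁, h₁'⟩ := hR_lift (le_max_left j₁ j₂) hj₁
    obtain ⟨i₂, hi₂, h₂, h₂'⟩ := hR_lift (le_max_right j₁ j₂) hj₂
    obtain ⟨hS, -, -⟩ := hGood (max j₁ j₂)
    have := (hwd hS ⟨i₁, hi₁⟩ ⟨i₂, hi₂⟩).1 (h₁.trans h₂.symm)
    rw [← h₁', ← h₂']
    exact this
  have hR_mem : ∀ {m m'}, R m m' → m ∈ C ∧ m' ∈ C' := by
    rintro m m' ⟨j, i, hi, rfl, rfl⟩
    obtain ⟨-, h1, h2⟩ := hGood j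
    exact ⟨h1 i hi, h2 i hi⟩
  have hR_dom : ∀ m ∈ C, ∃ m', R m m' := by
    intro m hm
    rw [he] at hm
    obtain ⟨j, rfl⟩ := hm
    obtain ⟨-, -, ⟨i, hi, hval⟩, -⟩ := hF _ (hGood j) j
    exact ⟨(seq (j + 1)).2.2 i, j + 1, i, hi, hval, rfl⟩
  have hR_ran : ∀ m' ∈ C', ∃ m, R m m' := by
    intro m' hm'
    rw [he'] at hm'
    obtain ⟨j, rfl⟩ := hm'
    obtain ⟨-, -, -, ⟨i, hi, hval⟩⟩ := hF _ (hGood j) j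
    exact ⟨(seq (j + 1)).2.1 i, j + 1, i, hi, rfl, hval⟩
  -- the limit map
  let g : M → M := fun m => if hm : ∃ m', R m m' then hm.choose else m
  have hg : ∀ {m m'}, R m m' → g m = m' := by
    intro m m' hmm'
    have hex : ∃ m', R m m' := ⟨m', hmm'⟩
    simp only [g, dif_pos hex]
    exact hR_fun hex.choose_spec hmm'
  have hgR : ∀ m ∈ C, R m (g m) := by
    intro m hm
    obtain ⟨m', hmm'⟩ := hR_dom m hm
    rwa [hg hmm']
  refine ⟨g, ?_, ?_⟩
  · apply Subset.antisymm
    · rintro _ ⟨m, hm, rfl⟩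
      exact (hR_mem (hgR m hm)).2
    · intro m' hm'
      obtain ⟨m, hmm'⟩ := hR_ran m' hm'
      exact ⟨m, (hR_mem hmm').1, hg hmm'⟩
  · intro m σ hσ
    have : ∀ i, ∃ j, ∃ p < (seq j).1, (seq j).2.1 p = σ i ∧ (seq j).2.2 p = g (σ i) :=
      fun i => hgR (σ i) (hσ i)
    choose j p hp hpσ hpg using this
    obtain ⟨J, hJ⟩ : ∃ J, ∀ i, j i ≤ J :=
      ⟨Finset.univ.sup j, fun i => Finset.le_sup (Finset.mem_univ i)⟩
    obtain ⟨hS, h1, h2⟩ := hGood J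
    have hpJ : ∀ i, p i < (seq J).1 := fun i => lt_of_lt_of_le (hp i) (hExt_le (hJ i)).1
    refine ⟨(seq J).1, (tup (seq J) (seq J).1).1, (tup (seq J) (seq J).1).2, hS,
      fun i => h1 i i.isLt, fun i => h2 i i.isLt, fun i => ⟨p i, hpJ i⟩, ?_, ?_⟩
    · funext i
      simp only [Function.comp_apply, tup]
      rw [((hExt_le (hJ i)).2 (p i) (hp i)).1, hpσ]
    · funext i
      simp only [Function.comp_apply, tup]
      rw [((hExt_le (hJ i)).2 (p i) (hp i)).2, hpg]

end BackAndForth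

/-! ### Re-indexing the matched tuples -/

section Reindex

/-- `EqQFTypeOver` is stable under re-indexing the matched tuples (sub-tuples, repetitions,
permutations). [folklore] -/
theorem _root_.FirstOrder.Language.EqQFTypeOver.comp_right {G : Set M} {f : M → M} {k n : ℕ}
    {t t' : Fin k → M} (h : L.EqQFTypeOver G f t t') (ι : Fin n → Fin k) :
    L.EqQFTypeOver G f (t ∘ ι) (t' ∘ ι) := by
  intro m σ hσ
  let κ : Fin (m + n) → Fin (m + k) := fun i =>
    Fin.addCases (fun j => Fin.castAdd k j) (fun j => Fin.natAdd m (ι j)) i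
  have e1 : Fin.append σ (t ∘ ι) = Fin.append σ t ∘ κ := by
    funext i
    refine Fin.addCases (fun j => ?_) (fun j => ?_) i <;> simp [κ]
  have e2 : Fin.append (f ∘ σ) (t' ∘ ι) = Fin.append (f ∘ σ) t' ∘ κ := by
    funext i
    refine Fin.addCases (fun j => ?_) (fun j => ?_) i <;> simp [κ]
  rw [e1, e2]
  exact (h σ hσ).comp κ

/-- `EqQFTypeOver G f t t'` with the tuples padded by the empty tuple. [folklore] -/
theorem _root_.FirstOrder.Language.EqQFTypeOver.append_elim0 {G : Set M} {f : M → M} {k : ℕ}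
    {t t' : Fin k → M} (h : L.EqQFTypeOver G f t t') :
    L.EqQFTypeOver G f (Fin.append t Fin.elim0) (Fin.append t' Fin.elim0) := by
  rw [Fin.append_elim0, Fin.append_elim0]
  exact h.comp_right _

end Reindex

/-! ### Partial embeddings preserve the closure (QM1) -/

section Closure

variable {cl : Set M → Set M}

/-- **Transport of closure along matched tuples** (QM1 over a set). If
`qftp(G, B, a) = qftp(f[G], B', b)` and `a ∈ cl (G ∪ range B)` then `b ∈ cl (f[G] ∪ range B')`.
[cite: BHHKK2014, Def. 2.1 (QM1)] -/
theorem IsWeaklyQuasiminimalPregeometryStructure.mem_cl_of_eqQFTypeOver_snoc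
    (hW : IsWeaklyQuasiminimalPregeometryStructure L M cl)
    {G : Set M} {f : M → M} {N : ℕ} {B B' : Fin N → M} {a b : M}
    (h : L.EqQFTypeOver G f (Fin.snoc B a : Fin (N + 1) → M) (Fin.snoc B' b))
    (ha : a ∈ cl (G ∪ range B)) : b ∈ cl (f '' G ∪ range B') := by
  have hP := hW.isPregeometry
  obtain ⟨A₀, hA₀, hA₀fin, haA₀⟩ := hP.finite_character ha
  obtain ⟨m, σ, hσ⟩ := (hA₀fin.inter_of_left G).fin_embedding
  have hσG : ∀ i, σ i ∈ G := fun i => ((hσ ▸ mem_range_self i : σ i ∈ A₀ ∩ G)).2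
  have key := h σ hσG
  rw [Fin.append_snoc, Fin.append_snoc] at key
  have ha' : a ∈ cl (range (Fin.append (σ : Fin m → M) B)) := by
    refine hP.mono ?_ haA₀
    intro c hc
    rw [range_append]
    rcases hA₀ hc with hcG | hcB
    · exact Or.inl (hσ ▸ ⟨hc, hcG⟩ : c ∈ range σ)
    · exact Or.inr hcB
  have := hW.mem_cl_of_eqQFType _ _ a b key ha'
  refine hP.mono ?_ this
  rw [range_append]
  refine union_subset_union_left _ ?_
  rintro _ ⟨i, rfl⟩
  exact ⟨σ i, hσG i, rfl⟩

/-- **Partial embeddings preserve the closure** (Kirby 2010, axiom I.3; here a consequence of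
QM1): if `f` is a partial embedding on `A`, `X ⊆ A`, `a ∈ A` and `a ∈ cl X`, then
`f a ∈ cl (f '' X)`. [cite: Kirby2010QMEC, §1 (axiom I.3)] -/
theorem IsQFEmbOn.mem_cl_image (hW : IsWeaklyQuasiminimalPregeometryStructure L M cl)
    {f : M → M} {A : Set M} (hf : IsQFEmbOn L f A) {X : Set M} (hX : X ⊆ A) {a : M} (ha : a ∈ A)
    (hacl : a ∈ cl X) : f a ∈ cl (f '' X) := by
  have hP := hW.isPregeometry
  obtain ⟨X₀, hX₀X, hX₀fin, haX₀⟩ := hP.finite_character hacl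
  obtain ⟨n, b, hb⟩ := hX₀fin.fin_embedding
  have hbA : ∀ i, b i ∈ A := fun i => hX (hX₀X (hb ▸ mem_range_self i))
  have hmem : ∀ i, (Fin.snoc (b : Fin n → M) a : Fin (n + 1) → M) i ∈ A := fun i => by
    refine Fin.lastCases ?_ (fun j => ?_) i
    · simpa using ha
    · simpa using hbA j
  have key := hf (Fin.snoc (b : Fin n → M) a) hmem
  have hsnoc : f ∘ (Fin.snoc (b : Fin n → M) a : Fin (n + 1) → M) = Fin.snoc (f ∘ b) (f a) := by
    funext i
    refine Fin.lastCases ?_ (fun j => ?_) i <;> simp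
  rw [hsnoc] at key
  have ha' : a ∈ cl (range b) := by rw [hb]; exact haX₀
  have := hW.mem_cl_of_eqQFType _ _ a (f a) key ha'
  refine hP.mono ?_ this
  rintro _ ⟨i, rfl⟩
  exact ⟨b i, hX₀X (hb ▸ mem_range_self i), rfl⟩

/-- Image of a closure under a partial embedding: `f '' cl X ⊆ cl (f '' X)` whenever
`cl X ⊆ A`. [folklore] -/
theorem IsQFEmbOn.image_cl_subset (hW : IsWeaklyQuasiminimalPregeometryStructure L M cl)
    {f : M → M} {A : Set M} (hf : IsQFEmbOn L f A) {X : Set M} (hclX : cl X ⊆ A) :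
    f '' cl X ⊆ cl (f '' X) := by
  rintro _ ⟨a, ha, rfl⟩
  exact hf.mem_cl_image hW ((hW.isPregeometry.subset_cl X).trans hclX) (hclX ha) ha

/-- **Image of a closure under a partial embedding, equality form**: if moreover
`cl (f '' X) ⊆ f '' A` then `f '' cl X = cl (f '' X)`. [folklore] -/
theorem IsQFEmbOn.image_cl_eq (hW : IsWeaklyQuasiminimalPregeometryStructure L M cl)
    {f : M → M} {A : Set M} (hf : IsQFEmbOn L f A) {X : Set M} (hclX : cl X ⊆ A)
    (hcl' : cl (f '' X) ⊆ f '' A) : f '' cl X = cl (f '' X) := by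
  have hX : X ⊆ A := (hW.isPregeometry.subset_cl X).trans hclX
  refine Subset.antisymm (hf.image_cl_subset hW hclX) ?_
  intro y hy
  obtain ⟨a, ha, rfl⟩ := hcl' hy
  refine ⟨a, ?_, rfl⟩
  haveI : Nonempty M := ⟨a⟩
  have hinv : LeftInvOn (Function.invFunOn f A) f A := hf.injOn.leftInvOn_invFunOn
  have hg : IsQFEmbOn L (Function.invFunOn f A) (f '' A) := hf.inverse hinv
  have := hg.mem_cl_image hW (image_mono hX) (mem_image_of_mem f ha) hy
  rw [hinv ha, (hinv.mono hX).image_image] at this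
  exact this

end Closure

/-! ### Closure extension over a closed set (QM5) and generic points (QM4) -/

namespace IsWeaklyQuasiminimalPregeometryStructure

variable {cl : Set M → Set M}

/-- **Closure extension over a closed set.** Let `M` be a countable weakly quasiminimal
pregeometry structure, `G ⊆ M` closed with `f[G]` closed (or `G = ∅`), and suppose
`qftp(G, t) = qftp(f[G], t')` along `f` (in particular `f` is a partial embedding on `G`). Then
there is a partial embedding `F` on `cl (G ∪ t)` agreeing with `f` on `G`, sending `t ↦ t'`, with
image exactly `cl (f[G] ∪ t')`. This is the back-and-forth of the successor step in Kirby 2010,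
Thm 2.1 ("Both `G_ν` and `G'_ν` are countable … using the `ℵ₀`-homogeneity over the countable
model `G_λ` …"), and of BHHKK 2014, Lemma 3.1. [cite: Kirby2010QMEC, Thm 2.1 (proof)] -/
theorem exists_isQFEmbOn_cl_extend
    (hW : IsWeaklyQuasiminimalPregeometryStructure L M cl) {G : Set M} {f : M → M}
    (hGc : G.Countable) (hG : (cl G = G ∧ cl (f '' G) = f '' G) ∨ G = ∅) {k : ℕ}
    {t t' : Fin k → M}
    (htt' : L.EqQFTypeOver G f t t') :
    ∃ F : M → M, IsQFEmbOn L F (cl (G ∪ range t)) ∧ EqOn F f G ∧ (∀ i, F (t i) = t' i) ∧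
      F '' cl (G ∪ range t) = cl (f '' G ∪ range t') := by
  classical
  have hP := hW.isPregeometry
  set C := cl (G ∪ range t) with hC
  set C' := cl (f '' G ∪ range t') with hC'
  have hGC : G ⊆ C := subset_union_left.trans (hP.subset_cl _)
  have htC : ∀ i, t i ∈ C := fun i => hP.subset_cl _ (Or.inr (mem_range_self i))
  have hfGC' : f '' G ⊆ C' := subset_union_left.trans (hP.subset_cl _)
  have ht'C' : ∀ i, t' i ∈ C' := fun i => hP.subset_cl _ (Or.inr (mem_range_self i))
  have hCcl : cl C = C := hP.cl_cl _
  have hC'cl : cl C' = C' := hP.cl_cl _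
  have hfG : IsQFEmbOn L f G := fun n σ hσ => (htt' σ hσ).append_left
  -- the degenerate case of an empty structure
  rcases isEmpty_or_nonempty M with hM | hM
  · refine ⟨f, fun n x _ => ?_, fun a _ => rfl, fun i => isEmptyElim (t i), ?_⟩
    · rcases Nat.eq_zero_or_pos n with rfl | hn
      · exact EqQFType.of_isEmpty x _
      · exact isEmptyElim (x ⟨0, hn⟩)
    · exact (eq_empty_of_isEmpty _).trans (eq_empty_of_isEmpty _).symm
  -- an inverse of `f` on `G`
  set g := Function.invFunOn f G with hgdef
  have hg : ∀ a ∈ G, g (f a) = a := fun a ha => hfG.injOn.leftInvOn_invFunOn ha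
  have hgG : g '' (f '' G) = G := LeftInvOn.image_image hg
  have hG' : (cl (f '' G) = f '' G ∧ cl (g '' (f '' G)) = g '' (f '' G)) ∨ f '' G = ∅ := by
    rcases hG with ⟨h1, h2⟩ | h
    · exact Or.inl ⟨h2, by rw [hgG]; exact h1⟩
    · exact Or.inr (by rw [h, image_empty])
  have hfg : ∀ b ∈ f '' G, f (g b) = b := fun b hb => LeftInvOn.rightInvOn_image hg hb
  -- the back-and-forth relation
  let S : ∀ n : ℕ, (Fin n → M) → (Fin n → M) → Prop := fun n x y =>
    L.EqQFTypeOver G f (Fin.append t x) (Fin.append t' y)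
  have h0 : S 0 Fin.elim0 Fin.elim0 := htt'.append_elim0
  have hwd : ∀ ⦃n⦄ ⦃x y : Fin n → M⦄, S n x y → ∀ i j, x i = x j ↔ y i = y j :=
    fun n x y hS i j => hS.eqQFType.append_right.apply_eq_iff i j
  have forth : ∀ ⦃n⦄ ⦃x y : Fin n → M⦄, S n x y → (∀ i, x i ∈ C) → (∀ i, y i ∈ C') →
      ∀ a ∈ C, ∃ b ∈ C', S (n + 1) (Fin.snoc x a) (Fin.snoc y b) := by
    intro n x y hS hx hy a ha
    have ha' : a ∈ cl (G ∪ range (Fin.append t x)) := by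
      refine hP.mono ?_ ha
      rw [range_append]
      exact union_subset_union_right _ subset_union_left
    obtain ⟨b, hb⟩ := hW.homogeneity_over_closed G f hGc hG _ _ hS ha'
    refine ⟨b, ?_, ?_⟩
    · have := hW.mem_cl_of_eqQFTypeOver_snoc hb ha'
      rw [← hC'cl]
      refine hP.mono ?_ this
      rw [range_append]
      refine union_subset hfGC' (union_subset ?_ ?_)
      · rintro _ ⟨i, rfl⟩; exact ht'C' i
      · rintro _ ⟨i, rfl⟩; exact hy i
    · change L.EqQFTypeOver G f (Fin.append t (Fin.snoc x a)) (Fin.append t' (Fin.snoc y b))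
      rwa [Fin.append_snoc, Fin.append_snoc]
  have back : ∀ ⦃n⦄ ⦃x y : Fin n → M⦄, S n x y → (∀ i, x i ∈ C) → (∀ i, y i ∈ C') →
      ∀ b ∈ C', ∃ a ∈ C, S (n + 1) (Fin.snoc x a) (Fin.snoc y b) := by
    intro n x y hS hx hy b hb
    have hS' : L.EqQFTypeOver (f '' G) g (Fin.append t' y) (Fin.append t x) :=
      hS.symm_of_inverse hg
    have hb' : b ∈ cl (f '' G ∪ range (Fin.append t' y)) := by
      refine hP.mono ?_ hb
      rw [range_append]
      exact union_subset_union_right _ subset_union_left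
    obtain ⟨a, ha⟩ := hW.homogeneity_over_closed (f '' G) g (hGc.image f) hG' _ _ hS' hb'
    refine ⟨a, ?_, ?_⟩
    · have := hW.mem_cl_of_eqQFTypeOver_snoc ha hb'
      rw [hgG] at this
      rw [← hCcl]
      refine hP.mono ?_ this
      rw [range_append]
      refine union_subset hGC (union_subset ?_ ?_)
      · rintro _ ⟨i, rfl⟩; exact htC i
      · rintro _ ⟨i, rfl⟩; exact hx i
    · have := ha.symm_of_inverse hfg
      rw [hgG] at this
      change L.EqQFTypeOver G f (Fin.append t (Fin.snoc x a)) (Fin.append t' (Fin.snoc y b))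
      rwa [Fin.append_snoc, Fin.append_snoc]
  obtain ⟨F, hFC, hcov⟩ := exists_map_of_backAndForth
    (hP.countable_cl hW.countable_cl (hGc.union (countable_range t)))
    (hP.countable_cl hW.countable_cl ((hGc.image f).union (countable_range t'))) h0 hwd forth back
  refine ⟨F, ?_, ?_, ?_, hFC⟩
  · intro m σ hσ
    obtain ⟨n, x, y, hS, -, -, ι, hx, hy⟩ := hcov σ hσ
    have := (hS.eqQFType.append_right).comp ι
    rwa [hx, hy] at this
  · intro a ha
    obtain ⟨n, x, y, hS, -, -, ι, hx, hy⟩ := hcov ![a] (fun i => by simpa using hGC ha)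
    have h1 : a = Fin.append t x (Fin.natAdd k (ι 0)) := by
      simp only [Fin.append_right]
      exact (congr_fun hx 0).symm
    have h2 := hS.apply_eq_of_mem ha h1
    rw [Fin.append_right] at h2
    have h3 : y (ι 0) = F a := by simpa using congr_fun hy 0
    rw [h2, h3]
  · intro i
    obtain ⟨n, x, y, hS, -, -, ι, hx, hy⟩ := hcov ![t i] (fun j => by simpa using htC i)
    have h1 : Fin.append t x (Fin.castAdd n i) = Fin.append t x (Fin.natAdd k (ι 0)) := by
      simp only [Fin.append_left, Fin.append_right]
      exact (congr_fun hx 0).symm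
    have h2 := hS.eqQFType.eq_of_eq h1
    simp only [Fin.append_left, Fin.append_right] at h2
    have h3 : y (ι 0) = F (t i) := by simpa using congr_fun hy 0
    rw [h2, h3]

/-- **Generic points over a closed set, with seeds** (QM4). With `G`, `f`, `t`, `t'` as in
`exists_isQFEmbOn_cl_extend`, points `a ∉ cl (G ∪ t)` and `a' ∉ cl (f[G] ∪ t')` can be
matched: `qftp(G, t, a) = qftp(f[G], t', a')`. (Kirby 2010, axiom II.1 applied over the closed
set `cl (G ∪ t)`; BHHKK 2014, Def. 2.1, QM4.) [cite: BHHKK2014, Def. 2.1 (QM4)] -/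
theorem eqQFTypeOver_snoc_of_notMem_cl
    (hW : IsWeaklyQuasiminimalPregeometryStructure L M cl) {G : Set M} {f : M → M}
    (hGc : G.Countable) (hG : (cl G = G ∧ cl (f '' G) = f '' G) ∨ G = ∅) {k : ℕ}
    {t t' : Fin k → M} (htt' : L.EqQFTypeOver G f t t') {a a' : M} (ha : a ∉ cl (G ∪ range t))
    (ha' : a' ∉ cl (f '' G ∪ range t')) :
    L.EqQFTypeOver G f (Fin.snoc t a : Fin (k + 1) → M) (Fin.snoc t' a') := by
  have hP := hW.isPregeometry
  obtain ⟨F, hF, hFf, hFt, hFim⟩ := hW.exists_isQFEmbOn_cl_extend hGc hG htt'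
  set H := cl (G ∪ range t) with hH
  have hHcl : cl H = H := hP.cl_cl _
  have hFHcl : cl (F '' H) = F '' H := by rw [hFim]; exact hP.cl_cl _
  have ha'' : a' ∉ F '' H := by rwa [hFim]
  have key := hW.uniqueness_of_generic_type H F
    (hP.countable_cl hW.countable_cl (hGc.union (countable_range t))) hHcl hFHcl
    hF.eqQFTypeOver_elim0 ha ha''
  intro m σ hσ
  have hσt : ∀ i, Fin.append σ t i ∈ H := fun i => by
    refine Fin.addCases (fun j => ?_) (fun j => ?_) i
    · simpa using subset_union_left.trans (hP.subset_cl _) (hσ j)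
    · simpa using hP.subset_cl _ (Or.inr (mem_range_self j) : t j ∈ G ∪ range t)
  have := key (Fin.append σ t) hσt
  have e1 : F ∘ Fin.append σ t = Fin.append (f ∘ σ) t' := by
    funext i
    refine Fin.addCases (fun j => ?_) (fun j => ?_) i
    · simpa using hFf (hσ j)
    · simpa using hFt j
  rw [e1, Fin.append_right_eq_snoc, Fin.append_right_eq_snoc, Matrix.cons_val_fin_one,
    Matrix.cons_val_fin_one, ← Fin.append_snoc, ← Fin.append_snoc] at this
  exact this

end IsWeaklyQuasiminimalPregeometryStructure

end Literature.ModelTheory.Quasiminimal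

end
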